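import Summits.BirchSwinnertonDyer.BirchSwinnertonDyer.Theses.DerivedKatoValuationDoor
import Summits.BirchSwinnertonDyer.BirchSwinnertonDyer.Theorems.DerivedKatoValuationDoorIntegralH1RankLeTwoOfAnalyticRankTwoOfNodeItems
import HarnessLib

/-!
# Line `birth` r6 — skeleton of the (β) deciding crux S2 `IntegralH1RankLeTwoOfAnalyticRankTwo`
# (route-BirchSwinnertonDyer-DerivedKatoValuationDoor rev 10, item stmt-BirchSwinnertonDyer-23752; LEAD bsd-line-dkd-p1,
# registry = g4 r5 / g5 r6 stubs verbatim; this file is the g6 local copy, reconstructed from the tree)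

S2 («at every door prime `p` — `5 ≤ p`, good ordinary, `ρ̄_{E,p}` onto — of a globally minimal `E/ℚ` of analytic rank two,
`rank_{ℤ_p} H¹(ℤ[1/p], T_pE) ≤ 2», Kato's `integralH1 (tateRep W p) p ⊤`) from TWO named stubs, composed PRINT-FREE through the
landed theorem `integralH1RankLeTwoOfAnalyticRankTwo_of_selCapTwoAtDoor_of_crisAt` (LEAD g4, p679701; it consumes INPUTS' landed
dictionary-≤ theorem `stub_rankIntegralH1LeSelmerCorankAtDoor`, honda-p1 p679321):

* `stub_selCapTwoAtDoorOfAnalyticRankTwo` — N1∣_door: `a = 2 ⇒ s_p ≤ 2` at door primes (OPEN; load-bearing; THE research stub;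
  ≡ ← half of item stmt-BirchSwinnertonDyer-0129 `SelmerRankRankTwo` on the door block, = first open cell of 0130 `SelmerRankUB`
  — `Theorems/…Transfer.lean` p678859, `…NodeEdges.lean` p679387);
* `stub_crisAtDoorPrimes` — ε: the route item `CrisAtDoorPrimes` (stmt-BirchSwinnertonDyer-23148) BY NAME (closed GIVEN the route's
  residual `PointsTwo`, `crisAtDoorPrimes_of_pointsTwo` p675908; open as typed only on the phantom cell `a = 2 ∧ r = 0`).

`lean check`: sorries ONLY inside the `stub_*` theorems; `IntegralH1RankLeTwoOfAnalyticRankTwo_of` is a real proof concluding the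
crux BY NAME (type literally the route decl).  BSD is not proved by any of this.
-/

set_option linter.dupNamespace false

noncomputable section

namespace Summit.BirchSwinnertonDyer.BirchSwinnertonDyer.Cruxes.IntegralH1RankLeTwoOfAnalyticRankTwo.Birth

open Summit.BirchSwinnertonDyer.BirchSwinnertonDyer.Theses.DerivedKatoValuationDoor
open Summit.BirchSwinnertonDyer.BirchSwinnertonDyer.Theorems.DerivedKatoValuationDoor

/-! ## §1 The skeleton (r6: two stubs) -/

/-- **Stub N1∣_door — `stub_selCapTwoAtDoorOfAnalyticRankTwo` (OPEN; load-bearing; BSD-strength).** At a door prime of a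
globally minimal analytic-rank-two curve, `corank_{ℤ_p} Sel_{p^∞}(W/ℚ) ≤ 2`.  Known toward it: `s_p ≤ ord_T char_Λ X(W/ℚ_∞)
≤ ord_T L_p(W,T)` at door primes (Mazur control + Kato 17.4); NOT known: `ord_T L_p ≤ 2` at `a = 2` (the order half of `p`-adic
BSD, node N2∣_door).  Why it might fail: `Ш(W)[p^∞]` of corank ≥ 2 at some door prime with `r = 2`, or `r ≥ 4`.
[cite: Kato2004Asterisque, Thm. 17.4 and Thm. 18.4] -/
theorem stub_selCapTwoAtDoorOfAnalyticRankTwo :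
    ∀ (W : WeierstrassCurve ℚ) [W.IsElliptic] [W.IsGloballyMinimal] (p : ℕ) [Fact p.Prime],
      W.analyticRank = 2 →
        (5 ≤ p ∧ Literature.NumberTheory.EllipticCurves.IsOrdinaryAt W p ∧ W.HasSurjectiveModNGaloisRep p) →
          W.selmerCorank p ≤ 2 := by
  sorry

/-- **Stub ε — `stub_crisAtDoorPrimes` (= route item stmt-BirchSwinnertonDyer-23148 `CrisAtDoorPrimes` BY NAME; closed given
`PointsTwo` by `crisAtDoorPrimes_of_pointsTwo`; open as typed only on the phantom cell `a = 2 ∧ r = 0`).**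
[cite: PerrinRiou1993AIF, Lemme 2.3.9] [cite: KuriharaPollack2007, Lemma 1.4] -/
theorem stub_crisAtDoorPrimes : CrisAtDoorPrimes := by
  sorry

/-- **Composition (kernel-checked, no sorry): the two stub STATEMENTS give the crux BY NAME**, print-free, through
`integralH1RankLeTwoOfAnalyticRankTwo_of_selCapTwoAtDoor_of_crisAt` (p679701). [cite: PerrinRiou1993AIF, Lemme 2.3.9] -/
theorem IntegralH1RankLeTwoOfAnalyticRankTwo_of :
    (∀ (W : WeierstrassCurve ℚ) [W.IsElliptic] [W.IsGloballyMinimal] (p : ℕ) [Fact p.Prime],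
      W.analyticRank = 2 →
        (5 ≤ p ∧ Literature.NumberTheory.EllipticCurves.IsOrdinaryAt W p ∧ W.HasSurjectiveModNGaloisRep p) →
          W.selmerCorank p ≤ 2) →
    CrisAtDoorPrimes →
    Summit.BirchSwinnertonDyer.BirchSwinnertonDyer.Theses.DerivedKatoValuationDoor.IntegralH1RankLeTwoOfAnalyticRankTwo :=
  fun hSel hCris => integralH1RankLeTwoOfAnalyticRankTwo_of_selCapTwoAtDoor_of_crisAt hSel hCris

/-- The same, from the named stubs (sanity; uses the stubs' sorries by design). -/
theorem IntegralH1RankLeTwoOfAnalyticRankTwo_of_stubs :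
    Summit.BirchSwinnertonDyer.BirchSwinnertonDyer.Theses.DerivedKatoValuationDoor.IntegralH1RankLeTwoOfAnalyticRankTwo :=
  IntegralH1RankLeTwoOfAnalyticRankTwo_of stub_selCapTwoAtDoorOfAnalyticRankTwo stub_crisAtDoorPrimes

/-- With the route's residual `PointsTwo` (stmt-BirchSwinnertonDyer-23026) in place of ε: the crux from N1∣_door alone. -/
theorem IntegralH1RankLeTwoOfAnalyticRankTwo_of_stub_of_pointsTwo (hPts : PointsTwo) :
    Summit.BirchSwinnertonDyer.BirchSwinnertonDyer.Theses.DerivedKatoValuationDoor.IntegralH1RankLeTwoOfAnalyticRankTwo :=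
  integralH1RankLeTwoOfAnalyticRankTwo_of_selCapTwoAtDoor_of_pointsTwo stub_selCapTwoAtDoorOfAnalyticRankTwo hPts

end Summit.BirchSwinnertonDyer.BirchSwinnertonDyer.Cruxes.IntegralH1RankLeTwoOfAnalyticRankTwo.Birth

end
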